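import Summits.NavierStokesRegularity.NavierStokesRegularity.Theorems.SoloRefuteSiche2026Steps23
import Summits.NavierStokesRegularity.NavierStokesRegularity.Theorems.SoloRefuteSiche2026Step5Global
import HarnessLib

/-!
# C135 `Siche2026` — refutation of Step 4 (Thm 6.28 (51) p. 22) and Step 5 (Thm 7.1 (53) p. 23)
# AT THE PRINTED GRAIN, and of the arithmetic face p. 14 (Lemma 6.7, proof Step B)

D-0090 NS-CLAIMS SWEEP, row C135 (`Literature.Claims.NS.Siche2026`, B. Siche, «Phase Decoherence and
Regularity of the Three-Dimensional Navier–Stokes Equations», Zenodo 10.5281/zenodo.19899171, v1.5;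
skeleton typist-3 g4 p500157, rev 2 p500644). Face (A) of the kit pool (ns-claims-typist-11 g4), built on
refuter-7 g2's blocks `SoloRefuteSiche2026HeatModes` / `Frame` / `Shear` / `Lattice` / `Steps23`
(the single-mode shear heat flow `shearFlow ν n α`, its typed shell coherence, `#S_{25^j} ≥ j + 1`) and the
quarter-period shift point of `SoloRefuteSiche2026Step5Global` (`xQuarter`, `mFourier_kx_xQuarter`).

**Countermodels** (exact classical solutions of the unforced system, zero pressure, every window `[0, T)`):
the `H¹`-NORMALISED single-mode shear heat flows `U(t, x) = Re(e^{-4π²νn²t} r α e^{2πinx₀}) ŷ`,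
`r = 1/‖Re(α e^{2πinx₀}) ŷ‖_{H¹}` (so `‖U(0)‖_{H¹} = 1` for every `n`), `n = 5^j`, active shell `K = 25^j`
with `N_K = 2·#S_K ≥ 2(j + 1)` unbounded in `j` (`exists_shell_card_gt`).

* `not_Step4_print` (Thm 6.28 (51) p. 22 with the printed constant `C(‖u₀‖_{H¹}, ν)`): SINE profile
  `α = -i`; in gauge (39) all four helical coordinates on the active shell are ALIGNED at `x = 0` for every
  `t` (`coherence_shearFlow_sine`: `χ_K(t)(0) = N_K`), so at `ν = 1`, `T = 2`, `t = 1` the values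
  `χ_{25^j}(1)(0) = N_{25^j}` exceed any `C(1)`.
* `not_Step5_print` (Thm 7.1 (53) p. 23 with the printed dependence `C' = C'(C, ‖u₀‖_{H¹}, ν)`): COSINE
  profile `α = 1`; at `x = 0` EVERY shell coherence vanishes for every `t` (`coherence_shearFlow_cosine_zero`,
  real profile), so the hypothesis holds with `C ≡ 0`, while at the shift `x_n = (1/(4n), 0, 0)`
  (`e_{n e₀}(x_n) = i`, `mFourier_kx_xQuarter`) `χ_{25^j}(1)(x_n) = N_{25^j}` (`coherence_shearFlow_cosine_xQuarter`)
  exceeds any `C'(1)`.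
* `not_Face_p14_dissipationRangeCount` (Lemma 6.7 proof Step B, p. 14 l. 56–59, «shells with
  νK^{2/3} ≥ 1 − c … satisfy χ_K ≤ N_K = O(1)», rev-2 decl): at `ν = 1`, `c = 1/2` every shell `K ≥ 1` is in
  range and `N_{25^j}` is unbounded — pure lattice counting.

The per-solution forms of record `Step4_globalDecoherence` / `Step5_shiftedCoherence` (constant depending on
the solution; the binders consumed by `claim_of_steps`) are refuted in refuter-7 g2's `SoloRefuteSiche2026Step4Global`
/ `SoloRefuteSiche2026Step5Global` by typist-10 g3's infinite-shell lacunary shear flows (a finite trigonometric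
polynomial cannot do it: finitely many shells, `χ_K ≤ N_K`); via the skeleton's `step4_of_print` / `step5_of_print`
those kills imply the present ones a fortiori — this file records the ELEMENTARY single-mode witnesses at the
print's own constant-dependence grain, with the `H¹` normalisation the printed constants call for.

WHAT THIS IS NOT: not a claim about NS regularity or blow-up; not a claim about any author beyond the
typed locator.
-/

set_option linter.dupNamespace false

noncomputable section

open Set
open Literature.Analysis.FunctionSpaces Literature.Analysis.FunctionSpaces.Torus
open Literature.Claims.NS.Siche2026
open UnitAddTorus (mFourier mFourierCoeff)
open scoped ComplexConjugate

namespace Summit.NavierStokesRegularity.NavierStokesRegularity.Theorems.Siche2026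

/-! ## `H¹` normalisation of the single-mode shear flow -/

/-- `H1norm` is absolutely homogeneous under real rescaling. [folklore] -/
theorem H1norm_smul (a : ℝ) (v : T3 → E3) : H1norm (a • v) = |a| * H1norm v := by
  unfold H1norm Torus.sobolevNorm
  have e : (EuclideanSpace.complexify ∘ (a • v)) = (a : ℂ) • (EuclideanSpace.complexify ∘ v) := by
    funext x
    simp only [Function.comp_apply, Pi.smul_apply]
    rw [map_smul, Complex.coe_smul]
  rw [e, Torus.eSobolevNorm_const_smul, ENNReal.toReal_mul]
  simp

/-- a smooth field with a non-zero Fourier coefficient has positive `H¹` norm. [folklore] -/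
theorem H1norm_pos_of_coeff_ne_zero {v : T3 → E3} (hv : IsSmooth v) {k₀ : Z3} (hne : coeff v k₀ ≠ 0) :
    0 < H1norm v := by
  unfold H1norm Torus.sobolevNorm
  have hfin : Torus.eSobolevNorm 1 (EuclideanSpace.complexify ∘ v) < ⊤ :=
    (hv.memSobolev_one_complexify).2
  refine ENNReal.toReal_pos ?_ hfin.ne
  have hne' : mFourierCoeff (EuclideanSpace.complexify ∘ v) k₀ ≠ 0 := hne
  have hterm : 0 < ENNReal.ofReal (Torus.sobolevWeight 1 k₀ ^ 2) *
      ‖mFourierCoeff (EuclideanSpace.complexify ∘ v) k₀‖ₑ ^ 2 := by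
    refine ENNReal.mul_pos ?_ ?_
    · exact (ENNReal.ofReal_pos.2 (pow_pos (Torus.sobolevWeight_pos 1 _) 2)).ne'
    · exact (ENNReal.pow_pos (enorm_pos.2 hne') 2).ne'
  have hle := ENNReal.le_tsum (f := fun k : Z3 => ENNReal.ofReal (Torus.sobolevWeight 1 k ^ 2) *
      ‖mFourierCoeff (EuclideanSpace.complexify ∘ v) k‖ₑ ^ 2) k₀
  have hpos := hterm.trans_le hle
  unfold Torus.eSobolevNorm at hfin ⊢
  refine (ENNReal.rpow_pos hpos ?_).ne'
  intro htop
  rw [htop, ENNReal.top_rpow_of_pos (by norm_num : (0:ℝ) < 1/2)] at hfin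
  exact lt_irrefl _ hfin

/-- the single streamwise mode `Re(α e^{2πinx₀}) ŷ` has positive `H¹` norm (`n ≠ 0`, `α ≠ 0`). [folklore] -/
theorem H1norm_shearMode_pos {n : ℤ} (hn : n ≠ 0) {α : ℂ} (hα : α ≠ 0) : 0 < H1norm (shearMode n α) := by
  refine H1norm_pos_of_coeff_ne_zero (isSmooth_realTrigPoly _ _) (k₀ := kx n) ?_
  rw [coeff_mode hn, if_pos rfl]
  intro h
  have := congr_arg (fun v : C3 => v 1) h
  simp [hα] at this

/-- real rescaling of the profile rescales the mode: `Re(rα e) ŷ = r · Re(α e) ŷ`. [folklore] -/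
theorem shearMode_ofReal_mul (n : ℤ) (r : ℝ) (α : ℂ) : shearMode n ((r : ℂ) * α) = r • shearMode n α := by
  funext x
  unfold shearMode
  rw [Pi.smul_apply, smul_realTrigPoly]
  refine congrFun (realTrigPoly_congr fun k _ => ?_) x
  exact yC_smul _ _

/-- at time `0` the shear heat flow is the mode itself. [folklore] -/
theorem shearFlow_zero (ν : ℝ) (n : ℤ) (α : ℂ) : shearFlow ν n α 0 = shearMode n α := by
  rw [shearFlow_eq]; simp

/-- the `H¹`-normalising amplitude `r = 1/‖Re(α e^{2πinx₀}) ŷ‖_{H¹}`. [folklore] -/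
def nrm (n : ℤ) (α : ℂ) : ℝ := (H1norm (shearMode n α))⁻¹

/-- the normalising amplitude is positive. [folklore] -/
theorem nrm_pos {n : ℤ} (hn : n ≠ 0) {α : ℂ} (hα : α ≠ 0) : 0 < nrm n α :=
  inv_pos.2 (H1norm_shearMode_pos hn hα)

/-- **unit `H¹` datum**: the shear flow with profile `nrm · α` has `‖U(0)‖_{H¹} = 1`, for every `n ≠ 0`.
[folklore] -/
theorem H1norm_shearFlow_nrm_zero (ν : ℝ) {n : ℤ} (hn : n ≠ 0) {α : ℂ} (hα : α ≠ 0) :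
    H1norm (shearFlow ν n ((nrm n α : ℂ) * α) 0) = 1 := by
  rw [shearFlow_zero, shearMode_ofReal_mul, H1norm_smul, abs_of_pos (nrm_pos hn hα), nrm]
  exact inv_mul_cancel₀ (H1norm_shearMode_pos hn hα).ne'

/-! ## Coherence of the sine and cosine flows -/

/-- the decayed rescaled profile: `e^{-λt} · (r α) = (e^{-λt} r) · α`. [folklore] -/
theorem ofReal_mul_ofReal_mul (e r : ℝ) (α : ℂ) :
    ((e : ℝ) : ℂ) * (((r : ℝ) : ℂ) * α) = (((e * r : ℝ)) : ℂ) * α := by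
  push_cast; ring

/-- **SINE flow, frozen phases**: for the profile `r · (−i)` (`r > 0`), `χ_K(t)(0) = N_K` on every shell
containing `n e₀`, at every time. [cite: Siche2026, Definition 4.1 p. 7 («fully coherent (aligned) phases,
χ_K = N_K»)] -/
theorem coherence_shearFlow_sine (ν : ℝ) {n : ℤ} (hn : 0 < n) {r : ℝ} (hr : 0 < r) {K : ℕ}
    (hK : kx n ∈ shell K) (t : ℝ) :
    coherence (shearFlow ν n ((r : ℂ) * -Complex.I) t) K 0 = shellModes K := by
  have he : 0 < Real.exp (-(rate ν (kx n) * t)) * r := mul_pos (Real.exp_pos _) hr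
  have hα : ((((Real.exp (-(rate ν (kx n) * t)) * r : ℝ)) : ℂ) * -Complex.I) ≠ 0 :=
    mul_ne_zero (by exact_mod_cast he.ne') (neg_ne_zero.2 Complex.I_ne_zero)
  rw [shearFlow_eq, ofReal_mul_ofReal_mul]
  unfold coherence
  rw [norm_magnetization_shearMode_zero_of_mem hn hα hK, abs_im_div_norm_of_sine he, one_pow, mul_one]

/-- **COSINE flow at `x = 0`**: for a real profile `r > 0`, `χ_K(t)(0) = 0` on EVERY shell at every time
(on the active shell `Im(e^{-λt} r) = 0`; the other shells are silent). [cite: Siche2026, Definition 4.1 p. 7] -/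
theorem coherence_shearFlow_cosine_zero (ν : ℝ) {n : ℤ} (hn : 0 < n) {r : ℝ} (hr : 0 < r) (K : ℕ)
    (t : ℝ) : coherence (shearFlow ν n (r : ℂ) t) K 0 = 0 := by
  have he : 0 < Real.exp (-(rate ν (kx n) * t)) * r := mul_pos (Real.exp_pos _) hr
  have hα : ((Real.exp (-(rate ν (kx n) * t)) * r : ℝ) : ℂ) ≠ 0 := by exact_mod_cast he.ne'
  rw [shearFlow_eq, ← Complex.ofReal_mul]
  by_cases hK : kx n ∈ shell K
  · rw [coherence_shearMode_zero_of_mem hn hα hK, Complex.ofReal_im]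
    simp
  · exact coherence_shearMode_of_not_mem hn hα hK 0

/-- the coherence ratio `Im(i a)²/|a|² = 1` of a non-zero real amplitude seen through `e_{n e₀}(x_n) = i`.
[folklore] -/
theorem im_I_mul_sq_div_norm_sq {a : ℝ} (ha : a ≠ 0) : (Complex.I * (a : ℂ)).im ^ 2 / ‖(a : ℂ)‖ ^ 2 = 1 := by
  have him : (Complex.I * (a : ℂ)).im = a := by simp
  rw [him, Complex.norm_real, Real.norm_eq_abs, sq_abs, div_self (pow_ne_zero 2 ha)]

/-- **COSINE flow at the shift `x_n`**: for a real profile `r > 0`, `χ_K(t)(x_n) = N_K` on every shell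
containing `n e₀`, at every time (`Im(i · a) = a`). [cite: Siche2026, Theorem 7.1 (52) p. 23 (shifted
coherence)] -/
theorem coherence_shearFlow_cosine_xQuarter (ν : ℝ) {n : ℤ} (hn : 0 < n) {r : ℝ} (hr : 0 < r) {K : ℕ}
    (hK : kx n ∈ shell K) (t : ℝ) : coherence (shearFlow ν n (r : ℂ) t) K (xQuarter n) = shellModes K := by
  have he : 0 < Real.exp (-(rate ν (kx n) * t)) * r := mul_pos (Real.exp_pos _) hr
  have hα : ((Real.exp (-(rate ν (kx n) * t)) * r : ℝ) : ℂ) ≠ 0 := by exact_mod_cast he.ne'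
  rw [shearFlow_eq, ← Complex.ofReal_mul, coherence_mode hn hα, if_pos hK, mFourier_kx_xQuarter hn.ne',
    im_I_mul_sq_div_norm_sq he.ne', mul_one]

/-- `#S_K ≤ N_K = 2·#S_K` as reals. [folklore] -/
theorem card_shell_le_shellModes (K : ℕ) : ((shell K).card : ℝ) ≤ shellModes K := by
  unfold shellModes; push_cast; linarith [Nat.cast_nonneg (α := ℝ) (shell K).card]

/-! ## Step 4 at the printed grain (Theorem 6.28 (51) p. 22) is false -/

/-- **`Step4_print` is false** (`Literature.Claims.NS.Siche2026.Step4_print`, Theorem 6.28 (51) p. 22 with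
its printed constant `C(‖u₀‖_{H¹}, ν)`): at `ν = 1` the unit-`H¹`-norm SINE shear heat flows with `n = 5^j`
give `χ_{25^j}(1)(0) = N_{25^j} ≥ #S_{25^j} > C(1)` for `j` large (`T = 2`, `t = 1`).
[cite: Siche2026, Theorem 6.28 (51) p. 22] -/
theorem not_Step4_print : ¬ Step4_print := by
  intro h
  obtain ⟨C, hC⟩ := h 1 one_pos
  obtain ⟨j, -, hjC⟩ := exists_shell_card_gt (C 1)
  have hn : (0 : ℤ) < 5 ^ j := by positivity
  have hK : kx ((5 : ℤ) ^ j) ∈ shell (25 ^ j) := kx_five_pow_mem_shell j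
  have hI : (-Complex.I) ≠ 0 := neg_ne_zero.2 Complex.I_ne_zero
  have hr : 0 < nrm ((5 : ℤ) ^ j) (-Complex.I) := nrm_pos hn.ne' hI
  have hle := hC 2 _ (fun _ _ => 0)
    (isClassicalNSSolutionOn_shearFlow 1 ((5 : ℤ) ^ j) ((nrm ((5 : ℤ) ^ j) (-Complex.I) : ℂ) * -Complex.I) 2)
    1 ⟨one_pos, one_lt_two⟩ (25 ^ j)
  rw [H1norm_shearFlow_nrm_zero 1 hn.ne' hI, coherence_shearFlow_sine 1 hn hr hK 1] at hle
  linarith [card_shell_le_shellModes (25 ^ j)]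

/-! ## The arithmetic face p. 14 (Lemma 6.7, proof Step B) is false -/

/-- **`Face_p14_dissipationRangeCount` is false** (Lemma 6.7 proof Step B, p. 14 l. 56–59: «Shells with
νK^{2/3} ≥ 1 − c lie in the dissipation range … and satisfy χ_K ≤ N_K = O(1)», rev-2 decl): at `ν = 1`,
`c = 1/2` every shell `K ≥ 1` is in range, yet `N_{25^j} ≥ #S_{25^j}` is unbounded in `j`.
[cite: Siche2026, Lemma 6.7 proof Step B p. 14 l. 56–59] -/
theorem not_Face_p14_dissipationRangeCount : ¬ Face_p14_dissipationRangeCount := by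
  intro h
  obtain ⟨N₀, hN⟩ := h 1 one_pos (1 / 2) (by norm_num)
  obtain ⟨j, -, hj⟩ := exists_shell_card_gt N₀
  have hK : (1 : ℝ) ≤ ((25 ^ j : ℕ) : ℝ) := by exact_mod_cast Nat.one_le_pow j 25 (by norm_num)
  have hr : 1 - (1 / 2 : ℝ) ≤ 1 * ((25 ^ j : ℕ) : ℝ) ^ ((2 : ℝ) / 3) := by
    have := Real.one_le_rpow hK (by norm_num : (0 : ℝ) ≤ 2 / 3)
    linarith
  have hle := hN (25 ^ j) hr
  linarith [card_shell_le_shellModes (25 ^ j)]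

/-! ## Step 5 at the printed grain (Theorem 7.1 (53) p. 23) is false -/

/-- **`Step5_print` is false** (`Literature.Claims.NS.Siche2026.Step5_print`, Theorem 7.1 (52)–(53) p. 23
with the printed dependence of `C'`): at `ν = 1`, `C ≡ 0`, the unit-`H¹`-norm COSINE shear heat flow with
`n = 5^j` has `χ_K(t)(0) = 0` for every shell and time (hypothesis), yet `χ_{25^j}(1)(x_n) = N_{25^j}`
at the shift `x_n = (1/(4n), 0, 0)`, exceeding any `C'(1)` for `j` large (`T = 2`, `t = 1`).
[cite: Siche2026, Theorem 7.1 (52)–(53) p. 23] -/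
theorem not_Step5_print : ¬ Step5_print := by
  intro h
  obtain ⟨C', hC'⟩ := h 1 one_pos (fun _ => 0)
  obtain ⟨j, -, hjC⟩ := exists_shell_card_gt (C' 1)
  have hn : (0 : ℤ) < 5 ^ j := by positivity
  have hK : kx ((5 : ℤ) ^ j) ∈ shell (25 ^ j) := kx_five_pow_mem_shell j
  have hr : 0 < nrm ((5 : ℤ) ^ j) 1 := nrm_pos hn.ne' one_ne_zero
  have h1 : H1norm (shearFlow 1 ((5 : ℤ) ^ j) (nrm ((5 : ℤ) ^ j) 1 : ℂ) 0) = 1 := by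
    simpa only [mul_one] using H1norm_shearFlow_nrm_zero 1 hn.ne' (one_ne_zero (α := ℂ))
  have hyp : ∀ t ∈ Ioo (0 : ℝ) 2, ∀ K : ℕ,
      coherence (shearFlow 1 ((5 : ℤ) ^ j) (nrm ((5 : ℤ) ^ j) 1 : ℂ) t) K 0 ≤
        (fun _ : ℝ => (0 : ℝ)) (H1norm (shearFlow 1 ((5 : ℤ) ^ j) (nrm ((5 : ℤ) ^ j) 1 : ℂ) 0)) :=
    fun t _ K => (coherence_shearFlow_cosine_zero 1 hn hr K t).le
  have hle := hC' 2 _ (fun _ _ => 0) (isClassicalNSSolutionOn_shearFlow 1 ((5 : ℤ) ^ j) _ 2) hyp 1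
    ⟨one_pos, one_lt_two⟩ (25 ^ j) (xQuarter ((5 : ℤ) ^ j))
  rw [h1, coherence_shearFlow_cosine_xQuarter 1 hn hr hK 1] at hle
  linarith [card_shell_le_shellModes (25 ^ j)]

end Summit.NavierStokesRegularity.NavierStokesRegularity.Theorems.Siche2026
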